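import Summits.ResolutionOfSingularities.ResolutionOfSingularities.Theorems.FrobeniusLadderFInjectiveMacaulayficationAutMonomialFloorCured
import Summits.ResolutionOfSingularities.ResolutionOfSingularities.Theorems.FrobeniusLadderFInjectiveMacaulayficationF108ConsumableRelHolds
import Summits.ResolutionOfSingularities.ResolutionOfSingularities.Theorems.FrobeniusLadderFInjectiveMacaulayficationFHalfRowOfWeaklyNondegenerateAnyField
import HarnessLib

/-!
# GAP-2 «k ≠ k̄» × GAP-1 ARM A: 𝔪-PRIMARY MONOMIAL FLOORS OF CONVENIENT GEOMETRICALLY-WND BEDS ARE CURED OVER ANY FIELD OF CHARACTERISTIC `p` — UNCONDITIONALLY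
# (crux `FInjectiveMacaulayfication` stmt-ResolutionOfSingularities-15315, chain w45a; seat res-L1-w45a-stub-2 g12, res-L1-w45a-plan-1 GO 2026-08-29T02:44:48Z; any-field twins of
# res-L1-w45a-stub-1's ✓ p685336 `MonomialFloorClassRow.{fHalfRowRel_of_tables, monomialFloorCured_of_F108ConsumableRel}` and ✓ p686042
# `AutMonomialFloorCured.autMonomialFloorCured_of_F108ConsumableRel`, with `hF` discharged by res-L1-toric-fan's ✓ p690554 `MonomialFloorClassRow.F108ConsumableRel_holds` and the one
# `k = k̄` callee swapped for this seat's ✓ `FHalfRowAnyField.affineBlowup_fullCl_of_geomWeaklyNondegenerate`)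

[OURS · L1 W4.5a] Support file (`--supports stmt-ResolutionOfSingularities-15315 --as helper`); def-free; UNCONDITIONAL; no named fact, no sorry, no new definition; NOT a statement of
any manuscript; replaces the role of NO printed item. Nothing of the crux is proved. AI-written (AI review weaker than expert review).

THE POINT. With ✓ `…F108ClassRowAnyField` the point-floor class theorems hold over every field of characteristic `p` (at `k`-rational vertices, geometric weak non-degeneracy).
This file does the same for the MONOMIAL-FLOOR column of the H_F class level (GAP-1 arm A): every theorem below is the original with `[IsAlgClosed k]` dropped, `(K : Type)
[Field K] [Algebra k K] [IsAlgClosed K]` added, `hWND` replaced by weak non-degeneracy of `map (algebraMap k K) f` (resp. `g`), and the interface hypothesis `hF` discharged.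
* §1 `fHalfRowRel_of_tables_anyField` — a monomial floor `(x^B)` cured from explicit tables, any field;
* §2 ★★ `monomialFloorCured_anyField` — EVERY `𝔪`-primary monomial floor of a prime convenient geometrically-WND isolated hypersurface point is CURED, any field, unconditionally;
* §3 ★★ `autMonomialFloorCured_anyField` — floors monomial in geometrically-WND coordinates reached by an origin-fixing polynomial automorphism, any field, unconditionally.
SCOPE (desk caveat, binding): `k`-RATIONAL vertices; nothing about admissibility or non-FULLness of the floors (per floor, by data, as before); closed points with residue field ≠ `k`
stay in GAP-2. [cite: IshiiSingularities2018, Thm. 4.4.23 and Cor. 4.4.25] [cite: StacksProject, Tag 080A] [cite: GortzWedhorn2020, (13.19)]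
-/

-- single-problem summit: the doubled namespace component is forced
set_option linter.dupNamespace false

noncomputable section

namespace Summit.ResolutionOfSingularities.ResolutionOfSingularities.Theorems.FInjectiveMacaulayfication.MonomialFloorAnyField

open CategoryTheory CategoryTheory.Limits AlgebraicGeometry TopologicalSpace IsLocalRing MvPolynomial
open Literature.AlgebraicGeometry.Resolution Literature.AlgebraicGeometry.Resolution.BoubakriGreuelMarkwig
open Summit.ResolutionOfSingularities.ResolutionOfSingularities.Theorems.FInjectiveMacaulayfication
open SliceableCentre GermForm GermRowTransport

variable (k : Type) [Field k] (K : Type) [Field K] [Algebra k K] [IsAlgClosed K] {n : ℕ}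

/-! ## §1 The data version over any field -/

/-- **A MONOMIAL FLOOR CURED FROM TABLES, ANY FIELD** (any-field twin of ✓ `MonomialFloorClassRow.fHalfRowRel_of_tables`: `[IsAlgClosed k]` dropped, the one callee swapped for
`FHalfRowAnyField.affineBlowup_fullCl_of_geomWeaklyNondegenerate`): `k` ANY field of characteristic `p`, `K ⊇ k` algebraically closed; `f` prime, with `map (algebraMap k K) f`
weakly non-degenerate along every positive weight (GEOMETRIC weak non-degeneracy), `x̄ᵢ ≠ 0`, `X` regular off the `k`-rational vertex; tables `A, KA, t, m, V, a, g, d` with `(x̄^A) = (x̄^B)·(x̄^KA)` in `k[X]/(f)`, `KA` and `B` containing pure powers of every variable,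
and the chart/cover/Newton certificates ⇒ for EVERY blowing up `g : S′ → Spec 𝒪_{X,v}` along `(x^B)~·𝒪_{X,v}` there is `𝓚 ≠ ⊥` on `S′`, supported over the closed point, all
of whose blowings up are FULL at every stalk. [OURS · assembly; cite: IshiiSingularities2018, Thm. 4.4.23; StacksProject, Tag 080A] -/
theorem fHalfRowRel_of_tables_anyField (p : ℕ) [Fact p.Prime] [CharP k p] (hn : 0 < n) (f : MvPolynomial (Fin n) k) (hfp : Prime f)
    (hWND : ∀ w : Fin n → ℝ, (∀ i, 0 < w i) →
      IsWeaklyNondegenerateAlong w ((map (algebraMap k K) f : MvPolynomial (Fin n) K) : MvPowerSeries (Fin n) K))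
    (hXne : ∀ v : Fin n, Ideal.Quotient.mk (Ideal.span {f}) (X v) ≠ 0)
    (hreg : ∀ x : Spec (.of (MvPolynomial (Fin n) k ⧸ Ideal.span {f})),
      ¬ Ideal.span (Set.range fun j : Fin n => Ideal.Quotient.mk (Ideal.span {f}) (X j)) ≤ x.asIdeal → IsRegularLocalRing (Localization.AtPrime x.asIdeal))
    (B : Finset (Fin n →₀ ℕ)) (hB : ∀ j : Fin n, ∃ N : ℕ, 0 < N ∧ Finsupp.single j N ∈ B)
    (A KA : Finset (Fin n →₀ ℕ))
    (hIA : Ideal.span ((fun e : Fin n →₀ ℕ => Ideal.Quotient.mk (Ideal.span {f}) (monomial e (1 : k))) '' (A : Set (Fin n →₀ ℕ))) =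
      Ideal.span ((fun e : Fin n →₀ ℕ => Ideal.Quotient.mk (Ideal.span {f}) (monomial e (1 : k))) '' (B : Set (Fin n →₀ ℕ))) *
        Ideal.span ((fun e : Fin n →₀ ℕ => Ideal.Quotient.mk (Ideal.span {f}) (monomial e (1 : k))) '' (KA : Set (Fin n →₀ ℕ))))
    (hKprim : ∀ j : Fin n, ∃ N : ℕ, Finsupp.single j N ∈ KA)
    (hprim : ∀ j ∈ (Finset.univ : Finset (Fin n)), ∃ N : ℕ, Finsupp.single j N ∈ A)
    (hAJ : ∀ a ∈ A, ∃ j ∈ (Finset.univ : Finset (Fin n)), 0 < a j)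
    (t : ℕ) (m : Fin t → (Fin n →₀ ℕ))
    (hcov : ∀ a ∈ A, ∃ (c : Fin t) (K : ℕ), 1 ≤ K ∧ ∃ y ∈ (Ideal.span ((fun b : Fin n →₀ ℕ => (MvPolynomial.monomial b (1 : k) : MvPolynomial (Fin n) k)) '' (A : Set (Fin n →₀ ℕ)))) ^ (K - 1),
      (MvPolynomial.monomial a (1 : k) : MvPolynomial (Fin n) k) ^ K = MvPolynomial.monomial (m c) 1 * y)
    (V : Fin t → Matrix (Fin n) (Fin n) ℕ) (hV : ∀ c, IsUnit ((V c).map (Nat.cast : ℕ → ℤ)).det)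
    (a : Fin t → Fin n → (Fin n →₀ ℕ)) (haA : ∀ c i, a c i ∈ A)
    (hgen : ∀ (c : Fin t) (i : Fin n), (Finsupp.equivFunOnFinite.symm ((V c).mulVec ⇑(a c i)) : Fin n →₀ ℕ) =
      Finsupp.equivFunOnFinite.symm ((V c).mulVec ⇑(m c)) + Finsupp.single i 1)
    (hge : ∀ (c : Fin t), ∀ e ∈ A, (Finsupp.equivFunOnFinite.symm ((V c).mulVec ⇑(m c)) : Fin n →₀ ℕ) ≤ Finsupp.equivFunOnFinite.symm ((V c).mulVec ⇑e))
    (g : Fin t → MvPolynomial (Fin n) k) (d : Fin t → (Fin n →₀ ℕ))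
    (hθ : ∀ c, aeval (fun j : Fin n => ∏ i : Fin n, (X i : MvPolynomial (Fin n) k) ^ V c i j) f = monomial (d c) 1 * g c)
    (hg0 : ∀ c, constantCoeff (g c) ≠ 0)
    (hv : ∀ c : Fin t, Ideal.Quotient.mk (Ideal.span {f}) (monomial (m c) (1 : k)) ∈
      Ideal.span ((fun e : Fin n →₀ ℕ => Ideal.Quotient.mk (Ideal.span {f}) (monomial e (1 : k))) '' (A : Set (Fin n →₀ ℕ))))
    (v : Spec (.of (MvPolynomial (Fin n) k ⧸ Ideal.span {f})))
    (hvm : v.asIdeal = Ideal.span (Set.range fun j : Fin n => Ideal.Quotient.mk (Ideal.span {f}) (X j))) :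
    ∀ (S' : Scheme.{0}) (gS : S' ⟶ Spec ((Spec (.of (MvPolynomial (Fin n) k ⧸ Ideal.span {f}))).presheaf.stalk v)),
      IsBlowup gS ((affineBlowup.idealSheaf (Ideal.span ((fun e : Fin n →₀ ℕ => Ideal.Quotient.mk (Ideal.span {f}) (monomial e (1 : k))) '' (B : Set (Fin n →₀ ℕ))))).comap
        ((Spec (.of (MvPolynomial (Fin n) k ⧸ Ideal.span {f}))).fromSpecStalk v)) →
      ∃ 𝓚 : S'.IdealSheafData, 𝓚 ≠ ⊥ ∧
        (∀ s ∈ (𝓚.support : Set S'), gS.base s = closedPoint ((Spec (.of (MvPolynomial (Fin n) k ⧸ Ideal.span {f}))).presheaf.stalk v)) ∧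
        ∀ (S'' : Scheme.{0}) (π : S'' ⟶ S'), IsBlowup π 𝓚 → ∀ s : S'', FullCl p (S''.presheaf.stalk s) := by
  classical
  haveI hfprime : (Ideal.span {f}).IsPrime := (Ideal.span_singleton_prime hfp.ne_zero).mpr hfp
  haveI : IsDomain (MvPolynomial (Fin n) k ⧸ Ideal.span {f}) := Ideal.Quotient.isDomain _
  have hmono : ∀ e : Fin n →₀ ℕ, Ideal.Quotient.mk (Ideal.span {f}) (monomial e (1 : k)) ≠ 0 := fun e =>
    CIConeFiModelCore.mk_monomial_ne_zero (Ideal.span {f}) hXne e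
  -- `τ = (x̄^B) ≠ ⊥`, `K ≠ ⊥`, `v ⊆ √K`
  have hτ : Ideal.span ((fun e : Fin n →₀ ℕ => Ideal.Quotient.mk (Ideal.span {f}) (monomial e (1 : k))) '' (B : Set (Fin n →₀ ℕ))) ≠ ⊥ := by
    intro h0
    obtain ⟨N, -, hN⟩ := hB ⟨0, hn⟩
    exact hmono _ ((Submodule.eq_bot_iff _).mp h0 _ (Ideal.subset_span ⟨_, hN, rfl⟩))
  have hK : Ideal.span ((fun e : Fin n →₀ ℕ => Ideal.Quotient.mk (Ideal.span {f}) (monomial e (1 : k))) '' (KA : Set (Fin n →₀ ℕ))) ≠ ⊥ := by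
    intro h0
    obtain ⟨N, hN⟩ := hKprim ⟨0, hn⟩
    exact hmono _ ((Submodule.eq_bot_iff _).mp h0 _ (Ideal.subset_span ⟨_, hN, rfl⟩))
  have hvK : v.asIdeal ≤ (Ideal.span ((fun e : Fin n →₀ ℕ => Ideal.Quotient.mk (Ideal.span {f}) (monomial e (1 : k))) '' (KA : Set (Fin n →₀ ℕ)))).radical := by
    rw [hvm, Ideal.span_le]
    rintro _ ⟨j, rfl⟩
    obtain ⟨N, hN⟩ := hKprim j
    exact ⟨N, by rw [← map_pow, X_pow_eq_monomial]; exact Ideal.subset_span ⟨_, hN, rfl⟩⟩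
  have hrow : ∀ y : ↥(affineBlowup (Ideal.span ((fun e : Fin n →₀ ℕ => Ideal.Quotient.mk (Ideal.span {f}) (monomial e (1 : k))) '' (B : Set (Fin n →₀ ℕ))) *
      Ideal.span ((fun e : Fin n →₀ ℕ => Ideal.Quotient.mk (Ideal.span {f}) (monomial e (1 : k))) '' (KA : Set (Fin n →₀ ℕ))))),
      FullCl p ((affineBlowup (Ideal.span ((fun e : Fin n →₀ ℕ => Ideal.Quotient.mk (Ideal.span {f}) (monomial e (1 : k))) '' (B : Set (Fin n →₀ ℕ))) *
        Ideal.span ((fun e : Fin n →₀ ℕ => Ideal.Quotient.mk (Ideal.span {f}) (monomial e (1 : k))) '' (KA : Set (Fin n →₀ ℕ))))).presheaf.stalk y) := by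
    rw [← hIA]
    exact FHalfRowAnyField.affineBlowup_fullCl_of_geomWeaklyNondegenerate p k K f hfp hWND hXne hreg A hprim hAJ t m hcov V hV a haA hgen hge g d hθ hg0 hv
  exact FHalfRowOfProductCentre.fHalfConclusion_of_affineBlowup_mul p _ _ hτ hK v hvK hrow

/-! ## §2 ★★ Every 𝔪-primary monomial floor, unconditionally, any field -/

/-- ★★ **EVERY `𝔪`-PRIMARY MONOMIAL FLOOR OF A CONVENIENT GEOMETRICALLY-WEAKLY-NON-DEGENERATE BED IS CURED — ANY FIELD OF CHARACTERISTIC `p`, UNCONDITIONAL** (any-field twin of ✓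
`MonomialFloorClassRow.monomialFloorCured_of_F108ConsumableRel` with `hF := MonomialFloorClassRow.F108ConsumableRel_holds k n` ✓ p690554 and `[IsAlgClosed k]` dropped). For
`f ∈ k[X₀..X_{n−1}]` (`n ≥ 1`, `k` ANY field of char `p`, `K ⊇ k` algebraically closed) prime, convenient, with `map (algebraMap k K) f` weakly non-degenerate along every positive weight, with `x̄ᵢ ≠ 0` and `X = V(f)` regular off the vertex `v`, and every finite `B` with a
positive pure power of every variable: for EVERY blowing up `g : S′ → Spec 𝒪_{X,v}` along the monomial floor `(x^B)~·𝒪_{X,v}` there is `𝓚 ≠ ⊥` on `S′`, supported over the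
closed point, ALL of whose blowings up are FULL at every stalk. Says nothing about the floor's admissibility or non-FULLness (per floor, by data). [OURS · class theorem, unconditional;
cite: IshiiSingularities2018, Thm. 4.4.23] [cite: StacksProject, Tag 080A] -/
theorem monomialFloorCured_anyField (p : ℕ) [Fact p.Prime] [CharP k p] (hn : 0 < n)
    (f : MvPolynomial (Fin n) k) (hfp : Prime f) (hconv : ∀ j : Fin n, ∃ N : ℕ, 0 < N ∧ MvPolynomial.coeff (Finsupp.single j N) f ≠ 0)
    (hWND : ∀ w : Fin n → ℝ, (∀ i, 0 < w i) →
      IsWeaklyNondegenerateAlong w ((map (algebraMap k K) f : MvPolynomial (Fin n) K) : MvPowerSeries (Fin n) K))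
    (hXne : ∀ v : Fin n, Ideal.Quotient.mk (Ideal.span {f}) (X v) ≠ 0)
    (hreg : ∀ x : Spec (.of (MvPolynomial (Fin n) k ⧸ Ideal.span {f})),
      ¬ Ideal.span (Set.range fun j : Fin n => Ideal.Quotient.mk (Ideal.span {f}) (X j)) ≤ x.asIdeal → IsRegularLocalRing (Localization.AtPrime x.asIdeal))
    (B : Finset (Fin n →₀ ℕ)) (hB : ∀ j : Fin n, ∃ N : ℕ, 0 < N ∧ Finsupp.single j N ∈ B)
    (v : Spec (.of (MvPolynomial (Fin n) k ⧸ Ideal.span {f})))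
    (hvm : v.asIdeal = Ideal.span (Set.range fun j : Fin n => Ideal.Quotient.mk (Ideal.span {f}) (X j))) :
    ∀ (S' : Scheme.{0}) (gS : S' ⟶ Spec ((Spec (.of (MvPolynomial (Fin n) k ⧸ Ideal.span {f}))).presheaf.stalk v)),
      IsBlowup gS ((affineBlowup.idealSheaf (Ideal.span ((fun e : Fin n →₀ ℕ => Ideal.Quotient.mk (Ideal.span {f}) (monomial e (1 : k))) '' (B : Set (Fin n →₀ ℕ))))).comap
        ((Spec (.of (MvPolynomial (Fin n) k ⧸ Ideal.span {f}))).fromSpecStalk v)) →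
      ∃ 𝓚 : S'.IdealSheafData, 𝓚 ≠ ⊥ ∧
        (∀ s ∈ (𝓚.support : Set S'), gS.base s = closedPoint ((Spec (.of (MvPolynomial (Fin n) k ⧸ Ideal.span {f}))).presheaf.stalk v)) ∧
        ∀ (S'' : Scheme.{0}) (π : S'' ⟶ S'), IsBlowup π 𝓚 → ∀ s : S'', FullCl p (S''.presheaf.stalk s) := by
  obtain ⟨A, KA, t, m, V, a, g, d, hIA, hKprim, hprim, hAJ, hcov, hV, haA, hgen, hge, hθ, hg0, hm⟩ := MonomialFloorClassRow.F108ConsumableRel_holds k n f hconv B hB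
  have hv : ∀ c : Fin t, Ideal.Quotient.mk (Ideal.span {f}) (monomial (m c) (1 : k)) ∈
      Ideal.span ((fun e : Fin n →₀ ℕ => Ideal.Quotient.mk (Ideal.span {f}) (monomial e (1 : k))) '' (A : Set (Fin n →₀ ℕ))) :=
    fun c => Ideal.subset_span ⟨m c, hm c, rfl⟩
  exact fHalfRowRel_of_tables_anyField k K p hn f hfp hWND hXne hreg B hB A KA (MonomialFloorClassRow.span_quotient_eq_mul_rel k _ A B KA hIA) hKprim hprim hAJ t m hcov V hV a haA hgen hge g d hθ hg0 hv v hvm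

/-! ## §3 ★★ Floors monomial in WND coordinates, unconditionally, any field -/

set_option maxHeartbeats 800000 in
-- large statement only
/-- ★★ **A FLOOR THAT IS MONOMIAL IN GEOMETRICALLY-WND COORDINATES IS CURED — ANY FIELD OF CHARACTERISTIC `p`, UNCONDITIONAL** (any-field twin of ✓
`AutMonomialFloorCured.autMonomialFloorCured_of_F108ConsumableRel`, `hF` discharged by ✓ `F108ConsumableRel_holds`, `[IsAlgClosed k]` dropped). Let `φ` be a ring automorphism of
`k[X₀..X_{n−1}]` (`n ≥ 1`, `k` ANY field of char `p`, `K ⊇ k` algebraically closed) with `φ(Xᵢ)`, `φ⁻¹(Xᵢ)` constant-term-free, `g = φ f` PRIME, CONVENIENT, with `map (algebraMap k K) g`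
WEAKLY NON-DEGENERATE along every positive weight, `x̄ᵢ ≠ 0` in `k[X]/(g)`, `V(g)` regular off the origin; let
`I ⊆ k[X]` be an ideal with `φ(I) = (x^B)`, `B` a finite exponent set with a positive pure power of every variable. Then for EVERY blowing up `S′ → Spec 𝒪_{V(f),v}` of the germ of
`V(f)` at the origin along the floor `(I mod f)~` there is `𝓚 ≠ ⊥` on `S′`, supported over the closed point, ALL of whose blowings up are FULL at every stalk. ONE application of
§2 to `(g, B)` and ✓ `AutMonomialFloorCured.exists_quotientEquiv_map` / `curedShape_of_ringEquiv` (field-general). Says nothing about admissibility or non-FULLness of the floor.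
[OURS · class theorem, unconditional; cite: IshiiSingularities2018, Thm. 4.4.23; GortzWedhorn2020, (13.19)] -/
theorem autMonomialFloorCured_anyField (p : ℕ) [Fact p.Prime] [CharP k p] (hn : 0 < n)
    (φ : MvPolynomial (Fin n) k ≃+* MvPolynomial (Fin n) k)
    (h₁ : ∀ i : Fin n, constantCoeff (φ (X i)) = 0) (h₂ : ∀ i : Fin n, constantCoeff (φ.symm (X i)) = 0)
    (f g : MvPolynomial (Fin n) k) (hfg : φ f = g) (hgp : Prime g)
    (hconv : ∀ j : Fin n, ∃ N : ℕ, 0 < N ∧ MvPolynomial.coeff (Finsupp.single j N) g ≠ 0)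
    (hWND : ∀ w : Fin n → ℝ, (∀ i, 0 < w i) →
      IsWeaklyNondegenerateAlong w ((map (algebraMap k K) g : MvPolynomial (Fin n) K) : MvPowerSeries (Fin n) K))
    (hXne : ∀ v : Fin n, Ideal.Quotient.mk (Ideal.span {g}) (X v) ≠ 0)
    (hreg : ∀ x : Spec (.of (MvPolynomial (Fin n) k ⧸ Ideal.span {g})),
      ¬ Ideal.span (Set.range fun j : Fin n => Ideal.Quotient.mk (Ideal.span {g}) (X j)) ≤ x.asIdeal → IsRegularLocalRing (Localization.AtPrime x.asIdeal))
    (I : Ideal (MvPolynomial (Fin n) k)) (B : Finset (Fin n →₀ ℕ)) (hB : ∀ j : Fin n, ∃ N : ℕ, 0 < N ∧ Finsupp.single j N ∈ B)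
    (hI : I.map φ.toRingHom = Ideal.span ((fun e : Fin n →₀ ℕ => (monomial e (1 : k) : MvPolynomial (Fin n) k)) '' (B : Set (Fin n →₀ ℕ))))
    (v' : Spec (.of (MvPolynomial (Fin n) k ⧸ Ideal.span {f})))
    (hv' : v'.asIdeal = Ideal.span (Set.range fun j : Fin n => Ideal.Quotient.mk (Ideal.span {f}) (X j))) :
    ∀ (S' : Scheme.{0}) (gS : S' ⟶ Spec ((Spec (.of (MvPolynomial (Fin n) k ⧸ Ideal.span {f}))).presheaf.stalk v')),
      IsBlowup gS ((affineBlowup.idealSheaf (I.map (Ideal.Quotient.mk (Ideal.span {f})))).comap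
        ((Spec (.of (MvPolynomial (Fin n) k ⧸ Ideal.span {f}))).fromSpecStalk v')) →
      ∃ 𝓚 : S'.IdealSheafData, 𝓚 ≠ ⊥ ∧
        (∀ s ∈ (𝓚.support : Set S'), gS.base s = closedPoint ((Spec (.of (MvPolynomial (Fin n) k ⧸ Ideal.span {f}))).presheaf.stalk v')) ∧
        ∀ (S'' : Scheme.{0}) (π : S'' ⟶ S'), IsBlowup π 𝓚 → ∀ s : S'', FullCl p (S''.presheaf.stalk s) := by
  obtain ⟨τ, hJ, -, horig⟩ := AutMonomialFloorCured.exists_quotientEquiv_map k φ h₁ h₂ f g hfg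
  -- the monomial floor of `V(g)`, as the image of `(x^B) ⊆ k[X]`
  set I₀ : Ideal (MvPolynomial (Fin n) k ⧸ Ideal.span {g}) :=
    (Ideal.span ((fun e : Fin n →₀ ℕ => (monomial e (1 : k) : MvPolynomial (Fin n) k)) '' (B : Set (Fin n →₀ ℕ)))).map (Ideal.Quotient.mk (Ideal.span {g})) with hI₀
  have hI₀' : I₀ = Ideal.span ((fun e : Fin n →₀ ℕ => Ideal.Quotient.mk (Ideal.span {g}) (monomial e (1 : k))) '' (B : Set (Fin n →₀ ℕ))) := by
    rw [hI₀, Ideal.map_span, Set.image_image]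
  -- (B‴) at the origin of `V(g)`, which is `(Spec τ) v′`
  have hcured := monomialFloorCured_anyField k K p hn g hgp hconv hWND hXne hreg B hB
    ((Spec.map (CommRingCat.ofHom τ.toRingHom)).base v') (horig v' hv')
  rw [← hI₀'] at hcured
  -- transport along `τ`; `τ I₀ = (φ⁻¹ (x^B)) mod f = I mod f`
  have hII : (I.map φ.toRingHom).map φ.symm.toRingHom = I := by
    rw [Ideal.map_map]
    have : φ.symm.toRingHom.comp φ.toRingHom = RingHom.id _ := RingHom.ext fun q => by simp
    rw [this, Ideal.map_id]
  have hmapI : I₀.map τ.toRingHom = I.map (Ideal.Quotient.mk (Ideal.span {f})) := by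
    rw [hI₀, hJ, ← hI, hII]
  have h := AutMonomialFloorCured.curedShape_of_ringEquiv p τ v' I₀ hcured
  rw [hmapI] at h
  exact h

end Summit.ResolutionOfSingularities.ResolutionOfSingularities.Theorems.FInjectiveMacaulayfication.MonomialFloorAnyField

end
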